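import Literature.AlgebraicTopology.KTheory.BottSurj
import Literature.AlgebraicTopology.KTheory.PencilBlocks
import Literature.AlgebraicTopology.KTheory.BottIndexAlg
import HarnessLib

/-!
# The index map of Bott periodicity, I: the `+`-class `[ζ₊]` of an invertible linear clutching matrix

For `a, b ∈ M_κ(C(X, ℂ))` with `z a + b` invertible over `X × S¹`, the class
`plusClass a b h = [im P₀] ∈ K⁰(X)` of the spectral projection (Husemöller, *Fibre Bundles*,
Ch. 11 Notation 4.7: `L(ζ, p)₊`), for an arbitrary finite index type `κ`, and its calculus:
invariance under re-indexing (`plusClass_reindex`), under left multiplication by units over `X`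
(`plusClass_unit_mul`) and conjugation (`plusClass_conj`), additivity over block sums
(`plusClass_fromBlocks`), the special pencils `plusClass_zero_left = 0`,
`plusClass_of_b_zero = |κ|`, **`plusClass_sp : [ (z P + (1-P))₊ ] = [P]`**, naturality
(`pullback_plusClass`) and homotopy invariance over `X × [0,1]` (`plusClass_slice_eq`).

Everything is proved; no named facts.

## References

* D. Husemöller, *Fibre Bundles*, 3rd ed. (1994) [HusemollerFibreBundles1994]: Ch. 11 §4
  (Props. 4.3, 4.5, 4.6, Notation 4.7), §5 (Thm. 5.4).
-/

noncomputable section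

open Set Metric unitInterval Complex

namespace Literature.AlgebraicTopology.KTheory

open Literature.RingTheory.KTheory Matrix Pencil Linearization

universe u

variable {X : Type u} [TopologicalSpace X]
variable {κ : Type} [Fintype κ] [DecidableEq κ]

/-! ### The `+`-class `[ζ₊]` of an invertible linear clutching matrix -/

/-- **The class `[ζ₊] ∈ K⁰(X)` of the `+`-bundle `im P₀`** of an invertible linear clutching matrix
`z a + b` (Husemöller, Ch. 11 Notation 4.7: `L(ζ, p)₊`). [cite: HusemollerFibreBundles1994, Ch. 11 Notation 4.7] -/
def plusClass (a b : Matrix κ κ C(X, ℂ)) (h : IsUnit (linClutch a b)) : K0 X :=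
  KZero.of (Idem.ofMatrix (specProj a b (isRegular_of_isUnit_linClutch h)) (isIdempotentElem_specProj a b _))

/-- `specProj` only depends on the pencil. [folklore] -/
theorem specProj_congr {a a' b b' : Matrix κ κ C(X, ℂ)} (hreg : ∀ x, IsRegular (evalAt a x) (evalAt b x))
    (hreg' : ∀ x, IsRegular (evalAt a' x) (evalAt b' x)) (ha : a = a') (hb : b = b') : specProj a b hreg = specProj a' b' hreg' := by
  subst ha hb; rfl

/-- Auxiliary statement for the index map of Bott periodicity. [folklore] -/
theorem plusClass_congr {a a' b b' : Matrix κ κ C(X, ℂ)} (h : IsUnit (linClutch a b)) (h' : IsUnit (linClutch a' b')) (ha : a = a')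
    (hb : b = b') : plusClass a b h = plusClass a' b' h' := by
  subst ha hb; rfl

/-- The `+`-class of two pencils with the same spectral projections. [folklore] -/
theorem plusClass_eq_of_specProj_eq {κ' : Type} [Fintype κ'] [DecidableEq κ'] {a b : Matrix κ κ C(X, ℂ)} {a' b' : Matrix κ' κ' C(X, ℂ)}
    (h : IsUnit (linClutch a b)) (h' : IsUnit (linClutch a' b'))
    (heq : AlgEquivalent (specProj a b (isRegular_of_isUnit_linClutch h)) (specProj a' b' (isRegular_of_isUnit_linClutch h'))) :
    plusClass a b h = plusClass a' b' h' :=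
  KZero.of_eq_of ((Idem.algEquivalent_ofMatrix _ _).trans (heq.trans (Idem.algEquivalent_ofMatrix _ _).symm))

/-- **Re-indexing invariance** of the `+`-class. [folklore] -/
theorem plusClass_reindex {κ' : Type} [Fintype κ'] [DecidableEq κ'] (e : κ ≃ κ') (a b : Matrix κ κ C(X, ℂ)) (h : IsUnit (linClutch a b))
    (h' : IsUnit (linClutch (Matrix.reindex e e a) (Matrix.reindex e e b))) :
    plusClass (Matrix.reindex e e a) (Matrix.reindex e e b) h' = plusClass a b h := by
  refine plusClass_eq_of_specProj_eq h' h ?_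
  have hP : specProj (Matrix.reindex e e a) (Matrix.reindex e e b) (isRegular_of_isUnit_linClutch h') =
      Matrix.reindex e e (specProj a b (isRegular_of_isUnit_linClutch h)) := by
    refine ext_evalAt fun x ↦ ?_
    rw [evalAt_specProj]
    have : evalAt (Matrix.reindex e e (specProj a b (isRegular_of_isUnit_linClutch h))) x =
        Matrix.reindex e e (evalAt (specProj a b (isRegular_of_isUnit_linClutch h)) x) := rfl
    rw [this, evalAt_specProj, ← (isRegular_of_isUnit_linClutch h x).P0_reindex e]
    rfl
  rw [hP]
  exact (AlgEquivalent.reindex (isIdempotentElem_specProj a b _) e).symm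

/-- `linClutch` is a unit iff its re-indexing is. [folklore] -/
theorem isUnit_linClutch_reindex {κ' : Type} [Fintype κ'] [DecidableEq κ'] (e : κ ≃ κ') {a b : Matrix κ κ C(X, ℂ)}
    (h : IsUnit (linClutch a b)) : IsUnit (linClutch (Matrix.reindex e e a) (Matrix.reindex e e b)) := by
  rw [← reindex_linClutch]; exact h.map (Matrix.reindexAlgEquiv ℂ _ e)

/-! ### Calculus of `+`-classes: units, block sums, special pencils -/

/-- Unit matrices over `X` have unit values and conversely. [folklore] -/
theorem isUnit_iff_forall_isUnit_evalAt (c : Matrix κ κ C(X, ℂ)) : IsUnit c ↔ ∀ x, IsUnit (evalAt c x) :=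
  ⟨fun h x ↦ isUnit_evalAt h x, isUnit_of_forall_isUnit_evalAt c⟩

omit [Fintype κ] [DecidableEq κ] in
/-- Auxiliary statement for the index map of Bott periodicity. [folklore] -/
theorem liftA_mul [Fintype κ] (c d : Matrix κ κ C(X, ℂ)) : liftA (c * d) = liftA c * liftA d := Matrix.map_mul

omit [DecidableEq κ] in
/-- `linClutch (c a) (c b) = liftA c · linClutch a b`. [folklore] -/
theorem linClutch_unit_mul (c a b : Matrix κ κ C(X, ℂ)) : linClutch (c * a) (c * b) = liftA c * linClutch a b := by
  have e := Matrix.mul_smul (liftA c) (zA : C(↥(pieceUp X ∩ pieceDn X), ℂ)) (liftA a)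
  rw [linClutch, linClutch, liftA_mul, liftA_mul, Matrix.mul_add, e]

/-- **Left multiplication by a unit over `X` does not change `[ζ₊]`.** [cite: HusemollerFibreBundles1994, Ch. 11 Prop. 4.6] -/
theorem plusClass_unit_mul {c a b : Matrix κ κ C(X, ℂ)} (hc : IsUnit c) (h : IsUnit (linClutch a b)) (h' : IsUnit (linClutch (c * a) (c * b))) :
    plusClass (c * a) (c * b) h' = plusClass a b h := by
  refine plusClass_eq_of_specProj_eq h' h ?_
  have hP : specProj (c * a) (c * b) (isRegular_of_isUnit_linClutch h') = specProj a b (isRegular_of_isUnit_linClutch h) := by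
    refine ext_evalAt fun x ↦ ?_
    rw [evalAt_specProj, evalAt_specProj]
    have e1 : evalAt (c * a) x = evalAt c x * evalAt a x := evalAt_mul _ _ _
    have e2 : evalAt (c * b) x = evalAt c x * evalAt b x := evalAt_mul _ _ _
    rw [P0_congr e1 e2]
    exact (isRegular_of_isUnit_linClutch h x).P0_unit_mul (isUnit_evalAt hc x)
  rw [hP]
  exact AlgEquivalent.refl (isIdempotentElem_specProj a b _)

/-- Auxiliary statement for the index map of Bott periodicity. [folklore] -/
theorem isUnit_linClutch_unit_mul {c a b : Matrix κ κ C(X, ℂ)} (hc : IsUnit c) (h : IsUnit (linClutch a b)) :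
    IsUnit (linClutch (c * a) (c * b)) := by
  rw [linClutch_unit_mul]; exact (hc.map (comapRingHom (πA (X := X))).mapMatrix).mul h

/-- **Conjugation by units over `X` does not change `[ζ₊]`** (conjugate idempotents are equivalent). [cite: HusemollerFibreBundles1994, Ch. 11 Prop. 4.6] -/
theorem plusClass_conj {c d a b : Matrix κ κ C(X, ℂ)} (hcd : c * d = 1) (hdc : d * c = 1) (h : IsUnit (linClutch a b))
    (h' : IsUnit (linClutch (c * a * d) (c * b * d))) : plusClass (c * a * d) (c * b * d) h' = plusClass a b h := by
  refine plusClass_eq_of_specProj_eq h' h ?_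
  set P := specProj a b (isRegular_of_isUnit_linClutch h)
  have hP := isIdempotentElem_specProj a b (isRegular_of_isUnit_linClutch h)
  have hP' : specProj (c * a * d) (c * b * d) (isRegular_of_isUnit_linClutch h') = c * P * d := by
    refine ext_evalAt fun x ↦ ?_
    rw [evalAt_specProj]
    conv_rhs => rw [evalAt_mul, evalAt_mul]; simp only [P]; rw [evalAt_specProj]
    have e1 : evalAt (c * a * d) x = evalAt c x * evalAt a x * evalAt d x := by rw [evalAt_mul, evalAt_mul]
    have e2 : evalAt (c * b * d) x = evalAt c x * evalAt b x * evalAt d x := by rw [evalAt_mul, evalAt_mul]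
    rw [P0_congr e1 e2]
    refine (isRegular_of_isUnit_linClutch h x).P0_conj ?_ ?_
    · rw [← evalAt_mul, hcd, evalAt_one]
    · rw [← evalAt_mul, hdc, evalAt_one]
  rw [hP']
  -- `c P d ∼ P` via `x = c P`, `y = P d`
  refine ⟨c * P, P * d, ?_, ?_, ?_, ?_⟩
  · rw [Matrix.mul_assoc c P (P * d), ← Matrix.mul_assoc P P d, hP.eq, Matrix.mul_assoc]
  · rw [Matrix.mul_assoc P d (c * P), ← Matrix.mul_assoc d c P, hdc, Matrix.one_mul, hP.eq]
  · calc c * P * (P * d) * (c * P) = c * (P * P) * (d * c) * P := by simp only [Matrix.mul_assoc]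
      _ = c * P := by rw [hP.eq, hdc, Matrix.mul_one, Matrix.mul_assoc, hP.eq]
  · calc P * d * (c * P) * (P * d) = P * (d * c) * (P * P) * d := by simp only [Matrix.mul_assoc]
      _ = P * d := by rw [hdc, Matrix.mul_one, hP.eq, hP.eq]

section Blocks

variable {κ₁ κ₂ : Type} [Fintype κ₁] [DecidableEq κ₁] [Fintype κ₂] [DecidableEq κ₂]

omit [Fintype κ₁] [DecidableEq κ₁] [Fintype κ₂] [DecidableEq κ₂] in
/-- Auxiliary statement for the index map of Bott periodicity. [folklore] -/
theorem evalAt_fromBlocks {Y : Type*} [TopologicalSpace Y] (A : Matrix κ₁ κ₁ C(Y, ℂ)) (B : Matrix κ₁ κ₂ C(Y, ℂ)) (C : Matrix κ₂ κ₁ C(Y, ℂ))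
    (D : Matrix κ₂ κ₂ C(Y, ℂ)) (y : Y) :
    evalAt (Matrix.fromBlocks A B C D) y = Matrix.fromBlocks (evalAt A y) (evalAt B y) (evalAt C y) (evalAt D y) :=
  Matrix.fromBlocks_map _ _ _ _ _

omit [Fintype κ₁] [DecidableEq κ₁] [Fintype κ₂] [DecidableEq κ₂] in
/-- Auxiliary statement for the index map of Bott periodicity. [folklore] -/
theorem evalAt_zero {Y : Type*} [TopologicalSpace Y] (y : Y) : evalAt (0 : Matrix κ₁ κ₂ C(Y, ℂ)) y = 0 := Matrix.map_zero _ (map_zero _)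

omit [Fintype κ₁] [DecidableEq κ₁] [Fintype κ₂] [DecidableEq κ₂] in
/-- Auxiliary statement for the index map of Bott periodicity. [folklore] -/
theorem liftA_fromBlocks (A : Matrix κ₁ κ₁ C(X, ℂ)) (B : Matrix κ₁ κ₂ C(X, ℂ)) (C : Matrix κ₂ κ₁ C(X, ℂ)) (D : Matrix κ₂ κ₂ C(X, ℂ)) :
    (Matrix.fromBlocks A B C D).map (comapRingHom (πA (X := X))) =
      Matrix.fromBlocks (A.map (comapRingHom πA)) (B.map (comapRingHom πA)) (C.map (comapRingHom πA)) (D.map (comapRingHom πA)) :=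
  Matrix.fromBlocks_map _ _ _ _ _

omit [Fintype κ₁] [DecidableEq κ₁] [Fintype κ₂] [DecidableEq κ₂] in
/-- `linClutch` of a block sum is the block sum. [folklore] -/
theorem linClutch_fromBlocks [Fintype κ₁] [DecidableEq κ₁] [Fintype κ₂] [DecidableEq κ₂] (a₁ b₁ : Matrix κ₁ κ₁ C(X, ℂ)) (a₂ b₂ : Matrix κ₂ κ₂ C(X, ℂ)) :
    linClutch (Matrix.fromBlocks a₁ 0 0 a₂) (Matrix.fromBlocks b₁ 0 0 b₂) = Matrix.fromBlocks (linClutch a₁ b₁) 0 0 (linClutch a₂ b₂) := by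
  rw [linClutch, liftA, liftA, liftA_fromBlocks, liftA_fromBlocks, Matrix.fromBlocks_smul, Matrix.fromBlocks_add]
  simp only [linClutch, Matrix.map_zero _ (map_zero _), add_zero]
  congr 1 <;> ext i j <;> simp

/-- **`[ζ₊]` is additive over block sums of pencils.** [cite: HusemollerFibreBundles1994, Ch. 11 Prop. 4.6] -/
theorem plusClass_fromBlocks (a₁ b₁ : Matrix κ₁ κ₁ C(X, ℂ)) (a₂ b₂ : Matrix κ₂ κ₂ C(X, ℂ)) (h₁ : IsUnit (linClutch a₁ b₁))
    (h₂ : IsUnit (linClutch a₂ b₂)) (h : IsUnit (linClutch (Matrix.fromBlocks a₁ 0 0 a₂) (Matrix.fromBlocks b₁ 0 0 b₂))) :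
    plusClass (Matrix.fromBlocks a₁ 0 0 a₂) (Matrix.fromBlocks b₁ 0 0 b₂) h = plusClass a₁ b₁ h₁ + plusClass a₂ b₂ h₂ := by
  have hP : specProj (Matrix.fromBlocks a₁ 0 0 a₂) (Matrix.fromBlocks b₁ 0 0 b₂) (isRegular_of_isUnit_linClutch h) =
      Matrix.fromBlocks (specProj a₁ b₁ (isRegular_of_isUnit_linClutch h₁)) 0 0 (specProj a₂ b₂ (isRegular_of_isUnit_linClutch h₂)) := by
    refine ext_evalAt fun x ↦ ?_
    rw [evalAt_specProj]
    have e1 : evalAt (Matrix.fromBlocks a₁ 0 0 a₂) x = Matrix.fromBlocks (evalAt a₁ x) 0 0 (evalAt a₂ x) := by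
      rw [evalAt_fromBlocks, evalAt_zero, evalAt_zero]
    have e2 : evalAt (Matrix.fromBlocks b₁ 0 0 b₂) x = Matrix.fromBlocks (evalAt b₁ x) 0 0 (evalAt b₂ x) := by
      rw [evalAt_fromBlocks, evalAt_zero, evalAt_zero]
    have e3 : evalAt (Matrix.fromBlocks (specProj a₁ b₁ (isRegular_of_isUnit_linClutch h₁)) 0 0 (specProj a₂ b₂ (isRegular_of_isUnit_linClutch h₂))) x =
        Matrix.fromBlocks (P0 (evalAt a₁ x) (evalAt b₁ x)) 0 0 (P0 (evalAt a₂ x) (evalAt b₂ x)) := by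
      rw [evalAt_fromBlocks, evalAt_zero, evalAt_zero, evalAt_specProj, evalAt_specProj]
    rw [P0_congr e1 e2, e3]
    exact (isRegular_of_isUnit_linClutch h₁ x).P0_fromBlocks (isRegular_of_isUnit_linClutch h₂ x)
  rw [plusClass, plusClass, plusClass, ← KZero.of_add]
  apply KZero.of_eq_of
  refine (Idem.algEquivalent_ofMatrix _ _).trans ?_
  rw [hP]
  exact (AlgEquivalent.fromBlocks (Idem.algEquivalent_ofMatrix _ _).symm (Idem.algEquivalent_ofMatrix _ _).symm).trans
    (Idem.add_equiv_fromBlocks _ _).symm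

/-- Auxiliary statement for the index map of Bott periodicity. [folklore] -/
theorem isUnit_linClutch_fromBlocks {a₁ b₁ : Matrix κ₁ κ₁ C(X, ℂ)} {a₂ b₂ : Matrix κ₂ κ₂ C(X, ℂ)} (h₁ : IsUnit (linClutch a₁ b₁))
    (h₂ : IsUnit (linClutch a₂ b₂)) : IsUnit (linClutch (Matrix.fromBlocks a₁ 0 0 a₂) (Matrix.fromBlocks b₁ 0 0 b₂)) := by
  rw [linClutch_fromBlocks]; exact Matrix.isUnit_fromBlocks_zero₂₁.2 ⟨h₁, h₂⟩

end Blocks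

/-! ### Classes of zero and identity idempotent matrices -/

omit [TopologicalSpace X] [DecidableEq κ] in
/-- `[0_κ] = 0`. [folklore] -/
theorem of_ofMatrix_zero [DecidableEq κ] {R : Type*} [CommRing R] (h : IsIdempotentElem (0 : Matrix κ κ R)) : KZero.of (Idem.ofMatrix (0 : Matrix κ κ R) h) = 0 := by
  rw [← KZero.of_zero]
  apply KZero.of_eq_of
  refine (Idem.algEquivalent_ofMatrix _ _).trans ⟨0, 0, ?_, ?_, ?_, ?_⟩
  · rw [Matrix.mul_zero]
  · rw [Matrix.mul_zero]; rfl
  · simp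
  · simp

/-- `[1_κ] = |κ|`. [folklore] -/
theorem of_ofMatrix_one {R : Type*} [CommRing R] (h : IsIdempotentElem (1 : Matrix κ κ R)) : KZero.of (Idem.ofMatrix (1 : Matrix κ κ R) h) = Fintype.card κ := by
  rw [← KZero.of_unit_eq_natCast]
  apply KZero.of_eq_of
  refine (Idem.algEquivalent_ofMatrix _ _).trans ?_
  change AlgEquivalent (1 : Matrix κ κ R) (1 : Matrix (Fin (Fintype.card κ)) (Fin (Fintype.card κ)) R)
  have h := AlgEquivalent.reindex (IsIdempotentElem.one (M := Matrix κ κ R)) (Fintype.equivFin κ)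
  rwa [Matrix.reindex_apply, Matrix.submatrix_one_equiv] at h

/-! ### Special pencils -/

/-- Computing `[ζ₊]` from an explicit formula for `P₀`. [folklore] -/
theorem plusClass_eq_of_specProj_eq_matrix {a b : Matrix κ κ C(X, ℂ)} (h : IsUnit (linClutch a b)) {M : Matrix κ κ C(X, ℂ)}
    (hM : specProj a b (isRegular_of_isUnit_linClutch h) = M) (hMi : IsIdempotentElem M) : plusClass a b h = KZero.of (Idem.ofMatrix M hMi) := by
  subst hM; rfl

/-- `a = 0`: `[ζ₊] = 0`. [cite: HusemollerFibreBundles1994, Ch. 11 Prop. 4.5] -/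
theorem plusClass_zero_left (b : Matrix κ κ C(X, ℂ)) (h : IsUnit (linClutch (0 : Matrix κ κ C(X, ℂ)) b)) : plusClass 0 b h = 0 := by
  have hP : specProj 0 b (isRegular_of_isUnit_linClutch h) = 0 := by
    refine ext_evalAt fun x ↦ ?_
    rw [evalAt_specProj, P0_congr (evalAt_zero x) rfl, P0_zero_left, evalAt_zero]
  rw [plusClass_eq_of_specProj_eq_matrix h hP IsIdempotentElem.zero, of_ofMatrix_zero]

/-- `b = 0`, `a` a unit: `[ζ₊] = |κ|` (the whole trivial bundle). [cite: HusemollerFibreBundles1994, Ch. 11 Prop. 4.5] -/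
theorem plusClass_of_b_zero {a : Matrix κ κ C(X, ℂ)} (ha : IsUnit a) (h : IsUnit (linClutch a 0)) : plusClass a 0 h = Fintype.card κ := by
  have hP : specProj a 0 (isRegular_of_isUnit_linClutch h) = 1 := by
    refine ext_evalAt fun x ↦ ?_
    rw [evalAt_specProj, P0_congr rfl (evalAt_zero x), P0_of_b_eq_zero (isUnit_evalAt ha x), evalAt_one]
  rw [plusClass_eq_of_specProj_eq_matrix h hP IsIdempotentElem.one, of_ofMatrix_one]

/-- The unit `-1`. [folklore] -/
theorem isUnit_neg_one_matrix : IsUnit (-1 : Matrix κ κ C(X, ℂ)) := ⟨⟨-1, -1, by simp, by simp⟩, rfl⟩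

section Sp

variable {n : ℕ}

/-- `[[1-e, e],[0,1]]` over `X`. [cite: HusemollerFibreBundles1994, Ch. 11 Thm. 5.4] -/
def spAX (e : Matrix (Fin n) (Fin n) C(X, ℂ)) : Matrix (Fin n ⊕ Fin n) (Fin n ⊕ Fin n) C(X, ℂ) := Matrix.fromBlocks (1 - e) e 0 1

variable (X n) in
/-- `[[0,0],[-1,0]]` over `X`. [cite: HusemollerFibreBundles1994, Ch. 11 Thm. 5.4] -/
def spBX : Matrix (Fin n ⊕ Fin n) (Fin n ⊕ Fin n) C(X, ℂ) := Matrix.fromBlocks 0 0 (-1) 0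

/-- Auxiliary statement for the index map of Bott periodicity. [folklore] -/
theorem evalAt_spAX (e : Matrix (Fin n) (Fin n) C(X, ℂ)) (x : X) : evalAt (spAX e) x = spA (evalAt e x) := by
  rw [spAX, evalAt_fromBlocks, evalAt_sub, evalAt_one, evalAt_zero]; rfl

/-- Auxiliary statement for the index map of Bott periodicity. [folklore] -/
theorem evalAt_spBX (x : X) : evalAt (spBX X n) x = spB (Fin n) := by
  rw [spBX, evalAt_fromBlocks, evalAt_zero]
  have : evalAt (-1 : Matrix (Fin n) (Fin n) C(X, ℂ)) x = -1 := by rw [evalAt, Matrix.map_neg _ (map_neg _), Matrix.map_one _ (map_zero _) (map_one _)]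
  rw [this]; rfl

/-- **The `+`-class of the linearised `z P + (1 - P)` is `[P]`.** [cite: HusemollerFibreBundles1994, Ch. 11 Thm. 5.4] -/
theorem plusClass_sp (e : Matrix (Fin n) (Fin n) C(X, ℂ)) (he : IsIdempotentElem e) (h : IsUnit (linClutch (spBX X n) (spAX e))) :
    plusClass (spBX X n) (spAX e) h = KZero.of (⟨n, e, he⟩ : Idem C(X, ℂ)) := by
  have hP : specProj (spBX X n) (spAX e) (isRegular_of_isUnit_linClutch h) = Matrix.fromBlocks e 0 0 0 := by
    refine ext_evalAt fun x ↦ ?_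
    rw [evalAt_specProj, P0_congr (evalAt_spBX x) (evalAt_spAX e x), evalAt_fromBlocks, evalAt_zero]
    exact P0_sp (by have := congrArg (fun M ↦ evalAt M x) he.eq; rwa [evalAt_mul] at this)
  have hz : KZero.of (⟨n, e, he⟩ : Idem C(X, ℂ)) = KZero.of (⟨n, e, he⟩ : Idem C(X, ℂ)) + KZero.of (Idem.ofMatrix (0 : Matrix (Fin n) (Fin n) C(X, ℂ)) IsIdempotentElem.zero) := by
    rw [of_ofMatrix_zero, add_zero]
  rw [plusClass_eq_of_specProj_eq_matrix h hP (isIdempotentElem_fromBlocks he IsIdempotentElem.zero), hz, ← KZero.of_add]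
  apply KZero.of_eq_of
  refine (Idem.algEquivalent_ofMatrix _ _).trans ?_
  refine AlgEquivalent.trans ?_ (Idem.add_equiv_fromBlocks _ _).symm
  exact AlgEquivalent.fromBlocks (AlgEquivalent.refl he) (Idem.algEquivalent_ofMatrix _ _).symm

end Sp

/-! ### Naturality and homotopy invariance of `[ζ₊]` -/

section Natural

variable {X' : Type*} [TopologicalSpace X']

omit [Fintype κ] [DecidableEq κ] in
/-- `linClutch` is natural under base change. [folklore] -/
theorem linClutch_map [Fintype κ] (a b : Matrix κ κ C(X, ℂ)) (f : C(X', X)) :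
    linClutch (a.map (comapRingHom f)) (b.map (comapRingHom f)) =
      (linClutch a b).map (comapRingHom (restrictMap (baseMap f) (mapsTo_inter (mapsTo_baseMap_pieceUp f) (mapsTo_baseMap_pieceDn f)))) := by
  refine ext_evalAt fun z ↦ ?_
  rw [evalAt_linClutch, evalAt_map, evalAt_map, evalAt_map, evalAt_linClutch]
  rfl

/-- Auxiliary statement for the index map of Bott periodicity. [folklore] -/
theorem isUnit_linClutch_map {a b : Matrix κ κ C(X, ℂ)} (h : IsUnit (linClutch a b)) (f : C(X', X)) :
    IsUnit (linClutch (a.map (comapRingHom f)) (b.map (comapRingHom f))) := by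
  rw [linClutch_map]; exact h.map (RingHom.mapMatrix _)

/-- **`[ζ₊]` is natural**: `f^*[ζ₊(a,b)] = [ζ₊(f^*a, f^*b)]`. [cite: HusemollerFibreBundles1994, Ch. 11 Prop. 4.3] -/
theorem pullback_plusClass [CompactSpace X] [T2Space X] [CompactSpace X'] [T2Space X'] (a b : Matrix κ κ C(X, ℂ)) (h : IsUnit (linClutch a b)) (f : C(X', X))
    (h' : IsUnit (linClutch (a.map (comapRingHom f)) (b.map (comapRingHom f)))) :
    pullback f (plusClass a b h) = plusClass (a.map (comapRingHom f)) (b.map (comapRingHom f)) h' := by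
  have hP : (specProj a b (isRegular_of_isUnit_linClutch h)).map (comapRingHom f) =
      specProj (a.map (comapRingHom f)) (b.map (comapRingHom f)) (isRegular_of_isUnit_linClutch h') := by
    refine ext_evalAt fun x' ↦ ?_
    rw [evalAt_map, evalAt_specProj, evalAt_specProj, P0_congr (evalAt_map a f x') (evalAt_map b f x')]
  rw [plusClass, plusClass, pullback_of]
  apply KZero.of_eq_of
  refine ((Idem.algEquivalent_ofMatrix _ _).map (comapRingHom f)).trans ?_
  rw [hP]
  exact (Idem.algEquivalent_ofMatrix _ _).symm

/-- **Homotopy invariance**: a family over `X × [0,1]` has the same `+`-class on all slices. [cite: HusemollerFibreBundles1994, Ch. 11 Prop. 4.8] -/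
theorem plusClass_slice_eq [CompactSpace X] [T2Space X] (aY bY : Matrix κ κ C(X × I, ℂ)) (h : IsUnit (linClutch aY bY)) (s t : I)
    (hs : IsUnit (linClutch (aY.map (comapRingHom (sliceIncl s))) (bY.map (comapRingHom (sliceIncl s)))))
    (ht : IsUnit (linClutch (aY.map (comapRingHom (sliceIncl t))) (bY.map (comapRingHom (sliceIncl t))))) :
    plusClass (aY.map (comapRingHom (sliceIncl s))) (bY.map (comapRingHom (sliceIncl s))) hs =
      plusClass (aY.map (comapRingHom (sliceIncl t))) (bY.map (comapRingHom (sliceIncl t))) ht := by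
  rw [← pullback_plusClass aY bY h, ← pullback_plusClass aY bY h, pullback_eq_of_homotopic (sliceIncl_homotopic s t)]

end Natural

end Literature.AlgebraicTopology.KTheory

end
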